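import Summits.ResolutionOfSingularities.ResolutionOfSingularities.Theorems.FrobeniusClosingSteerToricExitCriterion

/-!
# Crux `Steer` (stmt-ResolutionOfSingularities-16345) — §σ2.28 PROVER'S TOOL, part 2: the `Concl` form and the PRODUCER of `ToricExitAt`'s body

OURS (campaign res-hironaka, rung L ★L-G4, slot W4.1; res-type-028 g10 on res-L0-w41-plan-1 RULING 121b; statement file
`L/res-type-028/ToricExitCriterion.statement.lean` 953a0c568e4715e8, confirmed by res-L0-w41-strat-2 §12 12:45:17Z). Theses-free;
`--supports stmt-ResolutionOfSingularities-16345`, counted 0. NOT a statement of the manuscript under review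
[claim: Hironaka2017, status: under-review]; AI seat, weaker than expert review. Part 1 (`…ToricExitCriterion.lean`) proves (E1), the
hypersurface-chart lemma `isRegularLocalRing_locAtCentre_of_jacobianUnit`. This part:

* `concl_of_regular_locAtCentre` — the `locAtCentre` SANDWICH: a finitely generated `B ⊆ O` with `Frac B = K` and `locAtCentre B O`
  regular gives `Concl O A₀ t` for every finitely generated `A₀` and every `t` inside that local ring (model `k[B, gens A₀, t]`);
* **(E2)** `concl_of_jacobianUnit` — (E1) + the sandwich;
* `letter_mem_adjoin_of_inv_nonneg` — with `m⁻¹ ≥ 0` every letter is an `ℕ`-monomial in the chart monomials `z_j = y^{m_j}`;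
* **(E3)** `toricExitAt_of_jacobianUnit` — for a MONOMIAL-TYPE member `R N = locAtCentre k[x] O` (`x` algebraically independent,
  `span x = 𝔪`), letters `y = (s N, x)` (`s N ≠ 0`, `k(y) = K`, `trdeg_k K = n`), a unimodular `m` with `m⁻¹ ≥ 0` and all `z_j ∈ O`,
  and a relation `G(z) = 0` with a JACOBIAN UNIT: the BODY of `ToricExitAt O R s n N` VERBATIM with the given `x`, `m` (the skeleton leaf
  is `exact`), by (E1) and the sandwich `k[z] ≤ (R N)[s N][z] ≤ locAtCentre k[z] O`.
[cite: Matsumura1987, Thm. 14.2, Thm. 5.6] [cite: Teissier2014] [folklore]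
-/

noncomputable section

-- single-problem summit: the doubled namespace component `ResolutionOfSingularities` is forced
set_option linter.dupNamespace false

open scoped BigOperators

namespace Summit.ResolutionOfSingularities.ResolutionOfSingularities.Theorems.SteerToricExitCriterion

open IsLocalRing MvPolynomial
open Literature.AlgebraicGeometry.Resolution

section Producer

variable {k K : Type} [Field k] [Field K] [Algebra k K]

/-! ## §5 (E2) the `Concl` form and (E3) the producer of `ToricExitAt`'s body -/

/-- **Sandwich.** If `B ⊆ O` is a finitely generated `k`-subalgebra with `Frac B = K` whose local ring `L = locAtCentre B O` at the centre of
`O` is regular, then every finitely generated `A₀ ⊆ L` and every `t ∈ L` satisfy `Concl O A₀ t` (model `k[B, gens A₀, t]`, sandwiched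
`B ≤ A ≤ L`, so `locAtCentre A O = L`). OURS. [folklore] -/
theorem concl_of_regular_locAtCentre (O : ValuationSubring K) (B : Subalgebra k K) (hBfg : B.FG)
    (hBO : B.toSubring ≤ O.toSubring) [hBfr : IsFractionRing B K] (hreg : IsRegularLocalRing (locAtCentre B.toSubring O))
    (A₀ : Subalgebra k K) (hA₀ : A₀.FG) (hA₀L : A₀.toSubring ≤ locAtCentre B.toSubring O)
    (t : K) (ht : t ∈ locAtCentre B.toSubring O) :
    SwitchingDichotomy.Words.Concl O A₀ t := by
  classical
  obtain ⟨sB, hsB⟩ := hBfg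
  obtain ⟨s₀, hs₀⟩ := hA₀
  set Gset : Finset K := sB ∪ (s₀ ∪ {t}) with hGdef
  set A : Subalgebra k K := Algebra.adjoin k (Gset : Set K) with hAdef
  have hGset : (Gset : Set K) = (sB : Set K) ∪ ((s₀ : Set K) ∪ {t}) := by
    rw [hGdef, Finset.coe_union, Finset.coe_union, Finset.coe_singleton]
  have hAfg : A.FG := ⟨Gset, rfl⟩
  have hBA : B ≤ A := by
    rw [← hsB, hAdef, hGset]
    exact Algebra.adjoin_mono Set.subset_union_left
  have hA₀A : A₀ ≤ A := by
    rw [← hs₀, hAdef, hGset]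
    exact Algebra.adjoin_mono fun x hx => Or.inr (Or.inl hx)
  have htA : t ∈ A := by
    rw [hAdef, hGset]
    exact Algebra.subset_adjoin (Or.inr (Or.inr rfl))
  have hAL : A.toSubring ≤ locAtCentre B.toSubring O := by
    rw [hAdef, hGset]
    refine SteerToricConcl.adjoin_toSubring_le_locAtCentre O B ?_
    rintro x (hx | hx | hx)
    · exact le_locAtCentre _ O (show x ∈ B by rw [← hsB]; exact Algebra.subset_adjoin hx)
    · exact hA₀L (show x ∈ A₀ by rw [← hs₀]; exact Algebra.subset_adjoin hx)
    · rw [Set.mem_singleton_iff] at hx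
      rw [hx]
      exact ht
  have hAO : A.toSubring ≤ O.toSubring := hAL.trans (locAtCentre_le hBO)
  have hloc : locAtCentre A.toSubring O = locAtCentre B.toSubring O := by
    refine le_antisymm ?_ (locAtCentre_mono O (show B.toSubring ≤ A.toSubring from hBA))
    have h1 := locAtCentre_mono O hAL
    rwa [locAtCentre_locAtCentre] at h1
  have hAfr : IsFractionRing A K := isFractionRing_subalgebra_of_le B A hBA
  refine ⟨A, hAO, hA₀A, htA, hAfg, hAfr, ?_⟩
  have hAreg : IsRegularLocalRing (locAtCentre A.toSubring O) := by
    rw [hloc]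
    exact hreg
  exact (isRegularLocalRing_locAtCentre_iff hAO).mp hAreg

/-- **(E2) `Concl` form of (E1).** Under (E1)'s hypotheses every finitely generated `A₀` and every `t` lying in `locAtCentre k[z] O`
satisfy `Concl O A₀ t`. OURS. [folklore] -/
theorem concl_of_jacobianUnit (O : ValuationSubring K) (hk : ∀ c : k, algebraMap k K c ∈ O)
    {n : ℕ} (z : Fin (n + 1) → K) (hzO : ∀ j, z j ∈ O)
    (hzK : IntermediateField.adjoin k (Set.range z) = ⊤) (htr : Algebra.trdeg k K = n)
    (G : MvPolynomial (Fin (n + 1)) k) (hG : MvPolynomial.aeval z G = 0)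
    (hJ : ∃ j, O.valuation (MvPolynomial.aeval z (MvPolynomial.pderiv j G)) = 1)
    (A₀ : Subalgebra k K) (hA₀ : A₀.FG)
    (hA₀L : A₀.toSubring ≤ locAtCentre (Algebra.adjoin k (Set.range z)).toSubring O)
    (t : K) (ht : t ∈ locAtCentre (Algebra.adjoin k (Set.range z)).toSubring O) :
    SwitchingDichotomy.Words.Concl O A₀ t := by
  classical
  have hBfg : (Algebra.adjoin k (Set.range z)).FG := by
    refine ⟨Finset.univ.image z, ?_⟩
    rw [Finset.coe_image, Finset.coe_univ, Set.image_univ]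
  haveI : IsFractionRing (Algebra.adjoin k (Set.range z)) K := SteerToricConcl.isFractionRing_adjoin_of_adjoin_eq_top z hzK
  exact concl_of_regular_locAtCentre O (Algebra.adjoin k (Set.range z)) hBfg
    (adjoin_toSubring_le_of_subset_valuationSubring O hk (Set.range_subset_iff.mpr hzO))
    (isRegularLocalRing_locAtCentre_of_jacobianUnit O hk z hzO hzK htr G hG hJ) A₀ hA₀ hA₀L t ht

/-- With `W = m⁻¹ ≥ 0` entrywise, every letter `y i` is an `ℕ`-monomial in the chart monomials `z_j = ∏ l, y l ^ m j l`, hence lies in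
`k[z]` (`y_l ≠ 0`). OURS. [folklore] -/
theorem letter_mem_adjoin_of_inv_nonneg {N : ℕ} (y : Fin N → K) (hy0 : ∀ i, y i ≠ 0)
    (m : Matrix (Fin N) (Fin N) ℤ) (hm : IsUnit m.det) (hpos : ∀ i j, 0 ≤ m⁻¹ i j) (i : Fin N) :
    y i ∈ Algebra.adjoin k (Set.range fun j => ∏ l, y l ^ m j l) := by
  rw [SteerToricConcl.eq_prod_monomial_zpow_of_inv_mul y hy0 m m⁻¹ (Matrix.nonsing_inv_mul m hm) i]
  refine prod_mem fun j _ => ?_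
  rw [← Int.toNat_of_nonneg (hpos i j), zpow_natCast]
  exact Subalgebra.pow_mem _ (Algebra.subset_adjoin (Set.mem_range_self j)) _

/-- **(E3) THE TORIC EXIT CRITERION** — producer of the BODY of `ToricExitAt O R s n N` (r38 l.4953, VERBATIM as the conclusion; the
skeleton leaf is `exact`) for a MONOMIAL-TYPE member: `R N = locAtCentre k[x] O` with `x : Fin n → K` algebraically independent over `k`
and `span x = 𝔪_{R N}`; letters `y = (s N, x)` (`s N ≠ 0`) with `k(y) = K` and `trdeg_k K = n`; a unimodular `m` (`IsUnit m.det`) whose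
cone lies INSIDE THE POSITIVE ORTHANT (`0 ≤ (m⁻¹) i j`: each letter is an `ℕ`-monomial in the `z_j = y^{m_j}`) with all `z_j ∈ O`; and a
relation `G ∈ k[Z₀..Z_n]`, `G(z) = 0`, with a JACOBIAN UNIT at the centre. Then — with the GIVEN `x` and `m` — the body of `ToricExitAt`:
the local ring at the centre of `O` of `(R N)[s N][z]` is regular; it IS `locAtCentre k[z] O` of (E1), by the sandwich
`k[z] ≤ (R N)[s N][z] ≤ locAtCentre k[z] O` (`k[x] ≤ k[z]`, `s N ∈ k[z]`; `locAtCentre` is monotone and idempotent). OURS. [folklore]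
[cite: Teissier2014] -/
theorem toricExitAt_of_jacobianUnit (O : ValuationSubring K) (hk : ∀ c : k, algebraMap k K c ∈ O)
    {n : ℕ} (x : Fin n → K) (hx : AlgebraicIndependent k x)
    (R : ℕ → Subring K) (s : ℕ → K) (N : ℕ) (hs0 : s N ≠ 0)
    (hR : R N = locAtCentre (Algebra.adjoin k (Set.range x)).toSubring O) (hRloc : IsLocalRing (R N))
    (hxR : ∀ i, x i ∈ R N)
    (hspan : Ideal.span (Set.range fun i => (⟨x i, hxR i⟩ : R N)) = maximalIdeal (R N))
    (htr : Algebra.trdeg k K = n)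
    (hyK : IntermediateField.adjoin k (Set.range (Matrix.vecCons (s N) x)) = ⊤)
    (m : Matrix (Fin (n + 1)) (Fin (n + 1)) ℤ) (hm : IsUnit m.det) (hpos : ∀ i j, 0 ≤ m⁻¹ i j)
    (hmO : ∀ j, (∏ i, (Matrix.vecCons (s N) x) i ^ m j i) ∈ O)
    (G : MvPolynomial (Fin (n + 1)) k)
    (hG : MvPolynomial.aeval (fun j => ∏ i, (Matrix.vecCons (s N) x) i ^ m j i) G = 0)
    (hJ : ∃ j, O.valuation
      (MvPolynomial.aeval (fun j => ∏ i, (Matrix.vecCons (s N) x) i ^ m j i) (MvPolynomial.pderiv j G)) = 1) :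
    ∃ (_ : IsLocalRing (R N)) (x : Fin n → K) (hx : ∀ i, x i ∈ R N) (m : Matrix (Fin (n + 1)) (Fin (n + 1)) ℤ),
      Ideal.span (Set.range fun i => (⟨x i, hx i⟩ : R N)) = maximalIdeal (R N) ∧ IsUnit m.det ∧
      (∀ j, (∏ i, (Matrix.vecCons (s N) x) i ^ m j i) ∈ O) ∧
      IsRegularLocalRing (locAtCentre (Subring.closure ((R N : Set K) ∪
        insert (s N) (Set.range fun j => ∏ i, (Matrix.vecCons (s N) x) i ^ m j i))) O) := by
  classical
  set y : Fin (n + 1) → K := Matrix.vecCons (s N) x with hydef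
  set z : Fin (n + 1) → K := fun j => ∏ i, y i ^ m j i with hzdef
  have hy0 : ∀ i, y i ≠ 0 := by
    intro i
    refine Fin.cases ?_ (fun l => ?_) i
    · simpa [hydef] using hs0
    · simpa [hydef] using hx.ne_zero l
  -- the letters lie in `k[z]`, so `k(z) = K`
  set Bz : Subalgebra k K := Algebra.adjoin k (Set.range z) with hBzdef
  have hyBz : ∀ i, y i ∈ Bz := fun i => letter_mem_adjoin_of_inv_nonneg y hy0 m hm hpos i
  have hzK : IntermediateField.adjoin k (Set.range z) = ⊤ := by
    refine eq_top_iff.mpr ?_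
    rw [← hyK]
    refine IntermediateField.adjoin_le_iff.mpr ?_
    rintro _ ⟨i, rfl⟩
    exact IntermediateField.algebra_adjoin_le_adjoin k _ (hyBz i)
  have hregz : IsRegularLocalRing (locAtCentre Bz.toSubring O) :=
    isRegularLocalRing_locAtCentre_of_jacobianUnit O hk z hmO hzK htr G hG hJ
  have hBzO : Bz.toSubring ≤ O.toSubring :=
    adjoin_toSubring_le_of_subset_valuationSubring O hk (Set.range_subset_iff.mpr hmO)
  refine ⟨hRloc, x, hxR, m, hspan, hm, hmO, ?_⟩
  -- ### sandwich `k[z] ≤ (R N)[s N][z] ≤ locAtCentre k[z] O`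
  set C : Subring K := Subring.closure ((R N : Set K) ∪ insert (s N) (Set.range z)) with hCdef
  have hxBz : Algebra.adjoin k (Set.range x) ≤ Bz := by
    refine Algebra.adjoin_le ?_
    rintro _ ⟨l, rfl⟩
    have := hyBz l.succ
    simpa [hydef] using this
  have hRL : R N ≤ locAtCentre Bz.toSubring O := by
    rw [hR]
    exact locAtCentre_mono O (show (Algebra.adjoin k (Set.range x)).toSubring ≤ Bz.toSubring from hxBz)
  have hkR : ∀ c : k, algebraMap k K c ∈ R N := fun c => by
    rw [hR]
    exact le_locAtCentre _ O ((Algebra.adjoin k (Set.range x)).algebraMap_mem c)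
  have hBzC : Bz.toSubring ≤ C := by
    have : Bz ≤ { C with algebraMap_mem' := fun c => Subring.subset_closure (Or.inl (hkR c)) } :=
      Algebra.adjoin_le fun w hw => Subring.subset_closure (Or.inr (Set.mem_insert_of_mem _ hw))
    exact fun w hw => this hw
  have hCL : C ≤ locAtCentre Bz.toSubring O := by
    refine Subring.closure_le.mpr ?_
    rintro w (hw | rfl | ⟨j, rfl⟩)
    · exact hRL hw
    · have := hyBz 0
      simp [hydef] at this
      exact le_locAtCentre _ O this
    · exact le_locAtCentre _ O (Algebra.subset_adjoin (Set.mem_range_self j) : z j ∈ Bz)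
  have hloc : locAtCentre C O = locAtCentre Bz.toSubring O := by
    refine le_antisymm ?_ (locAtCentre_mono O hBzC)
    have h1 := locAtCentre_mono O hCL
    rwa [locAtCentre_locAtCentre] at h1
  rw [hloc]
  exact hregz

end Producer

end Summit.ResolutionOfSingularities.ResolutionOfSingularities.Theorems.SteerToricExitCriterion

end
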